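import Summits.QuantumFields.YangMills.Theorems.UnitScaleTiltProp7QTwSColumnBound
import Summits.QuantumFields.YangMills.Theorems.UnitScaleTiltProp7SectET3DeltaEtaExplicitT3
import Summits.QuantumFields.YangMills.Theorems.UnitScaleTiltProp7SecondOrderDictT3
import HarnessLib

/-!
# (q-gauge) SUPPLIER, ROW (T1) — **THE `QTwS`-COLUMN OF THE BCH CROSS TERM OF A GAUGE PARAMETER AGAINST A BOUNDED FIELD IS `O(ℓ⁻²)` IN THE `ℓ¹`-MASS OF THE PARAMETER**:
# `Σ_c ‖QTwS U₀ (b ↦ [N(b₋) + U₀(b)N(b₊)U₀(b)⁻¹, Y(b)]) c‖ ≤ 6·C_Q·(L^{K−n})⁻²·sup‖Y‖·Σ_x‖N x‖` at a printed-regular background — for a site spike `N = δ_x ⊗ A` this is the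
# row (T1) of px19 g14's S1-SPEC (19200 evidence #54) with `Σ_x‖N x‖ = ‖A‖` ([Balaban1985BackgroundPropagators] (3.13)–(3.15), (3.114)–(3.115); [Balaban1985Averaging] Prop. 3)

Cell `ym3-torus` (HUMAN RULING D-0037, YM ladder rung R3 — SU(2) YM₃ on T³: NOT d = 4, NOT infinite volume, NOT a mass gap, NOT Clay).  Width seat `ym3-torus-px19` (gen 14);
chair ★`ym-ust-19200-p1` g27 WORD №29 (2) «(q-gauge) → px19 g14»; S1-SPEC row (T1).  THEOREMS ONLY (0 `def`, 0 `sorry`, default heartbeats); `--supports stmt-QuantumFields-19200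
--as helper`; count-neutral.

WHY.  In the second-order gauge-covariance identity for `avgHess = D²(log U̿^{twS})(0)` (S1-SPEC (2)), the term (T1) is `−QTwS U₀ (B₁ Y N)` with `B₁ Y N (b)` the BCH cross term of the
chart gauge velocity, `∂_s∂_t mlog(e^{tN(b₋)}·e^{sY(b)}·Ad_{U₀(b)}(e^{−tN(b₊)}))|₀ = ½·[N(b₋) + Ad_{U₀(b)}N(b₊), Y(b)]` (from `log(e^Xe^Ye^Z) = X+Y+Z + ½([X,Y]+[X,Z]+[Y,Z]) + …`).  This file
bounds the `QTwS`-column of that commutator field by px13's (COL) engine ✓`Prop7QTwSColumnBound.sum_norm_QTwS_le` (`Σ_c‖QTwS Y c‖ ≤ C_Q·ℓ⁻²·Σ_b‖Y b‖`, K-free `C_Q ≤ 5` in the EX window) and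
the bond→site bookkeeping `Σ_b(‖N b₋‖ + ‖N b₊‖) = 2d·Σ_x‖N x‖` (✓`sum_pbond_eq`, the shift bijection) — so a pure-gauge parameter enters (T1) through its `ℓ¹`-MASS, which for a site spike is
`‖A‖`: the `ℓ⁻²` of (q-gauge)-core, term (T1).

WHAT IS PROVED (member `F`, `h : n ≤ K`, background `U₀` with `RegPr F n K ε₀ U₀` in the (COL) windows `10¹⁰L⁶ε₀ ≤ 1`, `10¹²L³ε₀ ≤ 1`).
* §1 `norm_comm_gaugeSum_le` (`‖[N b₋ + U₀N b₊U₀⁻¹, Y b]‖ ≤ 2·(‖N b₋‖ + ‖N b₊‖)·‖Y b‖`), `sum_norm_src_add_tgt_eq` (`Σ_b(‖N b₋‖ + ‖N b₊‖) = 2·3·Σ_x‖N x‖`).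
* §2 ★★ `sum_norm_QTwS_comm_gaugeSum_le` — the title for a general site field `N`; ★★★ `sum_norm_QTwS_comm_gaugeSpike_le` — the spike edition `N := Pi.single x A`:
  `Σ_c ‖QTwS U₀ (b ↦ [δ_xA(b₋) + U₀♭ δ_xA(b₊) U₀♭⁻¹, Y b]) c‖ ≤ 12·C_Q·((F.L:ℝ)^(K−n))⁻¹^2·s·‖A‖` for `sup‖Y‖ ≤ s`.
HONEST SCOPE.  Bookkeeping over (COL); the identity (S1-SPEC (2)) that makes this the (T1) term of `avgHess U₀ Y (gd(δ_xA))` is NOT proved here; nothing of (q-gauge)-core, `hqG`, `T_J`'s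
divergence row beyond ✓p768852's door, norm_G, EX, the crux or rung R3 is proved; the Yang–Mills mass gap is NOT proved.

References: T. Bałaban, CMP **99** (1985) 389–434 [Balaban1985BackgroundPropagators] ((3.13)–(3.15) p.393, (3.114)–(3.115) p.418); CMP **98** (1985) 17–51 [Balaban1985Averaging]
(Prop. 3 (124)–(126) p.36); CMP **102** (1985) 277–309 [Balaban1985Variational] ((2) p.278).
-/

set_option autoImplicit false

noncomputable section

open scoped BigOperators Matrix.Norms.L2Operator Matrix

namespace Summit.QuantumFields.YangMills.Theorems.Prop7AvgHessGaugeT1Row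

open Literature.MathematicalPhysics.QuantumFieldTheory.Balaban1983to89
open Literature.MathematicalPhysics.QuantumFieldTheory.Balaban1983to89.T3ContinuumYM3Torus
open T3PrintedRegularMinimiser (RegPr)
open T3SectALandauChart (bgUnits)
open B9TorusCalculus (torusT)
open Summit.QuantumFields.YangMills.Theorems.Prop7SymAvgTwSym (QTwS)
open Summit.QuantumFields.YangMills.Theorems.Prop7QTwSColumnBound (sum_norm_QTwS_le)
open Summit.QuantumFields.YangMills.Theorems.Prop7SectET3DeltaEtaExplicit (sum_pbond_eq)
open Summit.QuantumFields.YangMills.Theorems.Prop7SecondOrderDict (norm_bgUnits_le_one)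

variable {F : T3Family} {n K : ℕ} {h : n ≤ K}

/-! ## §1 Letters: the commutator entry and the bond→site mass -/

/-- `‖[N(b₋) + U₀(b)N(b₊)U₀(b)⁻¹, Y(b)]‖ ≤ 2·(‖N(b₋)‖ + ‖N(b₊)‖)·‖Y(b)‖` (unitary transport, submultiplicativity). [folklore] -/
theorem norm_comm_gaugeSum_le (U₀ : GaugeField (F.P K) 0 (Matrix.specialUnitaryGroup (Fin 2) ℂ)) (N : Site (F.P K) 0 → Matrix (Fin 2) (Fin 2) ℂ)
    (Y : PBond (F.P K) 0 → Matrix (Fin 2) (Fin 2) ℂ) (b : PBond (F.P K) 0) :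
    ‖(N b.src + ((bgUnits F K U₀ b : (Matrix (Fin 2) (Fin 2) ℂ)ˣ) : Matrix (Fin 2) (Fin 2) ℂ) * N b.tgt * (((bgUnits F K U₀ b)⁻¹ : (Matrix (Fin 2) (Fin 2) ℂ)ˣ) : Matrix (Fin 2) (Fin 2) ℂ)) * Y b
        - Y b * (N b.src + ((bgUnits F K U₀ b : (Matrix (Fin 2) (Fin 2) ℂ)ˣ) : Matrix (Fin 2) (Fin 2) ℂ) * N b.tgt * (((bgUnits F K U₀ b)⁻¹ : (Matrix (Fin 2) (Fin 2) ℂ)ˣ) : Matrix (Fin 2) (Fin 2) ℂ))‖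
      ≤ 2 * (‖N b.src‖ + ‖N b.tgt‖) * ‖Y b‖ := by
  set P : Matrix (Fin 2) (Fin 2) ℂ := N b.src + ((bgUnits F K U₀ b : (Matrix (Fin 2) (Fin 2) ℂ)ˣ) : Matrix (Fin 2) (Fin 2) ℂ) * N b.tgt
      * (((bgUnits F K U₀ b)⁻¹ : (Matrix (Fin 2) (Fin 2) ℂ)ˣ) : Matrix (Fin 2) (Fin 2) ℂ) with hP
  have hU := norm_bgUnits_le_one F K U₀ b
  have hAd : ‖((bgUnits F K U₀ b : (Matrix (Fin 2) (Fin 2) ℂ)ˣ) : Matrix (Fin 2) (Fin 2) ℂ) * N b.tgt * (((bgUnits F K U₀ b)⁻¹ : (Matrix (Fin 2) (Fin 2) ℂ)ˣ) : Matrix (Fin 2) (Fin 2) ℂ)‖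
      ≤ ‖N b.tgt‖ := by
    calc _ ≤ ‖((bgUnits F K U₀ b : (Matrix (Fin 2) (Fin 2) ℂ)ˣ) : Matrix (Fin 2) (Fin 2) ℂ)‖ * ‖N b.tgt‖ * ‖(((bgUnits F K U₀ b)⁻¹ : (Matrix (Fin 2) (Fin 2) ℂ)ˣ) : Matrix (Fin 2) (Fin 2) ℂ)‖ :=
          (norm_mul_le _ _).trans (mul_le_mul_of_nonneg_right (norm_mul_le _ _) (norm_nonneg _))
      _ ≤ 1 * ‖N b.tgt‖ * 1 := by gcongr <;> [exact hU.1; exact hU.2]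
      _ = ‖N b.tgt‖ := by ring
  have hPn : ‖P‖ ≤ ‖N b.src‖ + ‖N b.tgt‖ := (norm_add_le _ _).trans (add_le_add le_rfl hAd)
  calc ‖P * Y b - Y b * P‖ ≤ ‖P * Y b‖ + ‖Y b * P‖ := norm_sub_le _ _
    _ ≤ ‖P‖ * ‖Y b‖ + ‖Y b‖ * ‖P‖ := add_le_add (norm_mul_le _ _) (norm_mul_le _ _)
    _ = 2 * ‖P‖ * ‖Y b‖ := by ring
    _ ≤ 2 * (‖N b.src‖ + ‖N b.tgt‖) * ‖Y b‖ := by gcongr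

/-- **BOND→SITE MASS**: `Σ_b (‖N(b₋)‖ + ‖N(b₊)‖) = 2·d·Σ_x ‖N x‖` (`d = 3`; each site is the source of `d` bonds and, by the shift bijection, the target of `d` bonds). [folklore] -/
theorem sum_norm_src_add_tgt_eq (N : Site (F.P K) 0 → Matrix (Fin 2) (Fin 2) ℂ) :
    ∑ b : PBond (F.P K) 0, (‖N b.src‖ + ‖N b.tgt‖) = 2 * 3 * ∑ x : Site (F.P K) 0, ‖N x‖ := by
  rw [sum_pbond_eq]
  have hshift : ∀ μ : Fin (F.P K).d, ∑ x : Site (F.P K) 0, ‖N (x.shift μ)‖ = ∑ x : Site (F.P K) 0, ‖N x‖ := fun μ =>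
    Equiv.sum_comp (torusT (F.P K) 0 μ) (fun x => ‖N x‖)
  have hd : (Finset.univ : Finset (Fin (F.P K).d)).card = 3 := by rw [Finset.card_univ, Fintype.card_fin]; rfl
  have htgt : ∀ (x : Site (F.P K) 0) (μ : Fin (F.P K).d), (⟨x, μ⟩ : PBond (F.P K) 0).tgt = x.shift μ := fun _ _ => rfl
  simp only [htgt, Finset.sum_add_distrib]
  have h1 : ∑ x : Site (F.P K) 0, ∑ _μ : Fin (F.P K).d, ‖N x‖ = 3 * ∑ x : Site (F.P K) 0, ‖N x‖ := by
    rw [Finset.mul_sum]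
    exact Finset.sum_congr rfl fun x _ => by rw [Finset.sum_const, hd, nsmul_eq_mul, Nat.cast_ofNat]
  have h2 : ∑ x : Site (F.P K) 0, ∑ μ : Fin (F.P K).d, ‖N (x.shift μ)‖ = 3 * ∑ x : Site (F.P K) 0, ‖N x‖ := by
    rw [Finset.sum_comm]
    simp only [hshift]
    rw [Finset.sum_const, hd, nsmul_eq_mul, Nat.cast_ofNat]
  rw [h1, h2]
  ring

/-! ## §2 The (T1) row -/

/-- ★★ **THE `QTwS`-COLUMN OF THE BCH CROSS TERM, GENERAL GAUGE PARAMETER**: at `U₀ ∈ 𝔘_k(ε₀)` in the (COL) windows, for every site field `N` and bond field `Y` with `sup‖Y‖ ≤ s`,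
`Σ_c ‖QTwS U₀ (b ↦ [N(b₋) + U₀(b)N(b₊)U₀(b)⁻¹, Y(b)]) c‖ ≤ C_Q·((F.L:ℝ)^(K−n))⁻¹^2·(2·(2·3)·s·Σ_x‖N x‖)` — ✓`sum_norm_QTwS_le` ∘ §1.
[cite: Balaban1985BackgroundPropagators, (3.13)–(3.15) p.393, (3.114)–(3.115) p.418; Balaban1985Averaging, Prop. 3 (124)–(126) p.36] -/
theorem sum_norm_QTwS_comm_gaugeSum_le {ε₀ : ℝ} (hε₀ : 0 < ε₀) (hε : 10 ^ 10 * (F.L : ℝ) ^ 6 * ε₀ ≤ 1) (hε12 : 10 ^ 12 * (F.L : ℝ) ^ 3 * ε₀ ≤ 1)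
    (U₀ : GaugeField (F.P K) 0 (Matrix.specialUnitaryGroup (Fin 2) ℂ)) (hreg : RegPr F n K ε₀ U₀)
    (N : Site (F.P K) 0 → Matrix (Fin 2) (Fin 2) ℂ) (Y : PBond (F.P K) 0 → Matrix (Fin 2) (Fin 2) ℂ) {s : ℝ} (hY : ∀ b, ‖Y b‖ ≤ s) :
    ∑ c : PBond (F.P n) 0, ‖QTwS F n K h U₀ (fun b : PBond (F.P K) 0 =>
        (N b.src + ((bgUnits F K U₀ b : (Matrix (Fin 2) (Fin 2) ℂ)ˣ) : Matrix (Fin 2) (Fin 2) ℂ) * N b.tgt * (((bgUnits F K U₀ b)⁻¹ : (Matrix (Fin 2) (Fin 2) ℂ)ˣ) : Matrix (Fin 2) (Fin 2) ℂ)) * Y b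
          - Y b * (N b.src + ((bgUnits F K U₀ b : (Matrix (Fin 2) (Fin 2) ℂ)ˣ) : Matrix (Fin 2) (Fin 2) ℂ) * N b.tgt * (((bgUnits F K U₀ b)⁻¹ : (Matrix (Fin 2) (Fin 2) ℂ)ˣ) : Matrix (Fin 2) (Fin 2) ℂ))) c‖
      ≤ (Real.sqrt 2 * (2 * Real.exp ((159 * ((((F.P K).d + 2) * (F.P K).L : ℕ) : ℝ) * (2 * ((F.P K).d : ℝ)))
              / ((((F.P K).L : ℝ) ^ (F.P K).d)⁻¹ * ((F.P K).L : ℝ)) * (((((F.P K).d + 2) * (F.P K).L : ℕ) : ℝ) ^ 2 / 16 * ε₀)) + 1))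
          * ((F.L : ℝ) ^ (K - n))⁻¹ ^ 2 * (2 * (2 * 3) * s * ∑ x : Site (F.P K) 0, ‖N x‖) := by
  refine (sum_norm_QTwS_le F h hε₀ hε hε12 U₀ hreg _).trans ?_
  refine mul_le_mul_of_nonneg_left ?_ (by positivity)
  calc ∑ b : PBond (F.P K) 0, ‖(N b.src + ((bgUnits F K U₀ b : (Matrix (Fin 2) (Fin 2) ℂ)ˣ) : Matrix (Fin 2) (Fin 2) ℂ) * N b.tgt * (((bgUnits F K U₀ b)⁻¹ : (Matrix (Fin 2) (Fin 2) ℂ)ˣ) : Matrix (Fin 2) (Fin 2) ℂ)) * Y b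
          - Y b * (N b.src + ((bgUnits F K U₀ b : (Matrix (Fin 2) (Fin 2) ℂ)ˣ) : Matrix (Fin 2) (Fin 2) ℂ) * N b.tgt * (((bgUnits F K U₀ b)⁻¹ : (Matrix (Fin 2) (Fin 2) ℂ)ˣ) : Matrix (Fin 2) (Fin 2) ℂ))‖
      ≤ ∑ b : PBond (F.P K) 0, 2 * (‖N b.src‖ + ‖N b.tgt‖) * s :=
        Finset.sum_le_sum fun b _ => (norm_comm_gaugeSum_le U₀ N Y b).trans (mul_le_mul_of_nonneg_left (hY b) (by positivity))
    _ = 2 * s * ∑ b : PBond (F.P K) 0, (‖N b.src‖ + ‖N b.tgt‖) := by rw [Finset.mul_sum]; exact Finset.sum_congr rfl fun b _ => by ring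
    _ = 2 * (2 * 3) * s * ∑ x : Site (F.P K) 0, ‖N x‖ := by rw [sum_norm_src_add_tgt_eq]; ring

/-- ★★★ **THE (T1) ROW FOR A SITE SPIKE**: `N := δ_x ⊗ A` gives `Σ_x′‖N x′‖ = ‖A‖`, hence the `QTwS`-column of the BCH cross term of the pure-gauge spike against a bounded `Y` is
`≤ 12·C_Q·((F.L:ℝ)^(K−n))⁻¹^2·s·‖A‖` — the `ℓ⁻²` currency of (q-gauge)-core (S1-SPEC), term (T1). [cite: Balaban1985BackgroundPropagators, (3.114)–(3.115) p.418; Balaban1985Averaging, Prop. 3 p.36] -/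
theorem sum_norm_QTwS_comm_gaugeSpike_le {ε₀ : ℝ} (hε₀ : 0 < ε₀) (hε : 10 ^ 10 * (F.L : ℝ) ^ 6 * ε₀ ≤ 1) (hε12 : 10 ^ 12 * (F.L : ℝ) ^ 3 * ε₀ ≤ 1)
    (U₀ : GaugeField (F.P K) 0 (Matrix.specialUnitaryGroup (Fin 2) ℂ)) (hreg : RegPr F n K ε₀ U₀)
    (x : Site (F.P K) 0) (A : Matrix (Fin 2) (Fin 2) ℂ) (Y : PBond (F.P K) 0 → Matrix (Fin 2) (Fin 2) ℂ) {s : ℝ} (hY : ∀ b, ‖Y b‖ ≤ s) :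
    ∑ c : PBond (F.P n) 0, ‖QTwS F n K h U₀ (fun b : PBond (F.P K) 0 =>
        ((Pi.single x A : Site (F.P K) 0 → Matrix (Fin 2) (Fin 2) ℂ) b.src
            + ((bgUnits F K U₀ b : (Matrix (Fin 2) (Fin 2) ℂ)ˣ) : Matrix (Fin 2) (Fin 2) ℂ) * (Pi.single x A : Site (F.P K) 0 → Matrix (Fin 2) (Fin 2) ℂ) b.tgt
              * (((bgUnits F K U₀ b)⁻¹ : (Matrix (Fin 2) (Fin 2) ℂ)ˣ) : Matrix (Fin 2) (Fin 2) ℂ)) * Y b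
          - Y b * ((Pi.single x A : Site (F.P K) 0 → Matrix (Fin 2) (Fin 2) ℂ) b.src
            + ((bgUnits F K U₀ b : (Matrix (Fin 2) (Fin 2) ℂ)ˣ) : Matrix (Fin 2) (Fin 2) ℂ) * (Pi.single x A : Site (F.P K) 0 → Matrix (Fin 2) (Fin 2) ℂ) b.tgt
              * (((bgUnits F K U₀ b)⁻¹ : (Matrix (Fin 2) (Fin 2) ℂ)ˣ) : Matrix (Fin 2) (Fin 2) ℂ))) c‖
      ≤ 12 * (Real.sqrt 2 * (2 * Real.exp ((159 * ((((F.P K).d + 2) * (F.P K).L : ℕ) : ℝ) * (2 * ((F.P K).d : ℝ)))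
              / ((((F.P K).L : ℝ) ^ (F.P K).d)⁻¹ * ((F.P K).L : ℝ)) * (((((F.P K).d + 2) * (F.P K).L : ℕ) : ℝ) ^ 2 / 16 * ε₀)) + 1))
          * ((F.L : ℝ) ^ (K - n))⁻¹ ^ 2 * s * ‖A‖ := by
  classical
  have hmass : ∑ x' : Site (F.P K) 0, ‖(Pi.single x A : Site (F.P K) 0 → Matrix (Fin 2) (Fin 2) ℂ) x'‖ = ‖A‖ := by
    rw [Finset.sum_eq_single x]
    · rw [Pi.single_eq_same]
    · intro z _ hz; rw [Pi.single_eq_of_ne hz, norm_zero]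
    · intro hx; exact absurd (Finset.mem_univ x) hx
  have hmain := sum_norm_QTwS_comm_gaugeSum_le (h := h) hε₀ hε hε12 U₀ hreg (Pi.single x A) Y hY
  rw [hmass] at hmain
  refine hmain.trans (le_of_eq ?_)
  ring

end Summit.QuantumFields.YangMills.Theorems.Prop7AvgHessGaugeT1Row

end
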